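import Summits.QuantumFields.BalabanUV.Beta.GAN24.T2DriftHalfMemberOfDivergences
import Summits.QuantumFields.BalabanUV.Beta.GAN24.T2ShapeHalfMemberOfLetterRows
import Summits.QuantumFields.BalabanUV.Beta.GAN24.HalfMemberSlavedDivergenceDrift
import Summits.QuantumFields.BalabanUV.Beta.GAN24.HalfMemberSlavedDivergenceDriftSnd

/-!
# `BalabanUV.Beta.GAN24.T2DriftHalfMemberOfLetterRows` — binder row G-an2-4 ∕ (CONV-C), W-slot, the (α-0) parity re-cut, (α-END-c′) at the LETTER level, PART B:
# **«T2Drift^{ε}» FROM THE RAW TABLE LAWS WITH PARITIES, THE S-STEP SLOT LETTERS AND THEIR ONE-STEP DRIFTS, THE LEG ROWS AND THEIR DRIFTS, AND `hC`** — PART A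
# `T2DriftHalfMemberOfDivergences.rate_halfMember_three_of_divergence_rows` with its FOUR SLOT rows SUPPLIED: on `y_l` by this lineage's (b1) PART 4
# `HalfMemberSlavedDivergenceLetters.slotLetters_halfMember_succ_of_rows` + p2 g35's F4 (`T2RecSourceRows.source_rows_three_of_srecAt_rows`.1) + member `0`
# (leaf-03 g66's FILE 3b route, her `rows_of_zero_succ`), on `y_{l+2} − y_{l+1}` by PART 6a ∕ 6b `slotLetters_halfMember_succ_sub_of_rows` ∕ `slotLetters_snd_…`
# + F4's Cauchy half (`.2` at one step), on `y_1 − y_0` by the two level rows (`locStencil₂_diff`); the drift twin of leaf-03's FILE 3b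
# (G-an2-4 FORMAL swarm → CRUX TEAM (2), leaf-01 lineage `b2b-balaban-gan24-formalise-leaf-01`, gen 73; journal INTENT 2 [LEAF01-G73-INTENT2]; p2 g45 W-10 GO)

NOT IN PRINT; OUR BOOKKEEPING ([folklore] compositions BY NAME + `min`∕`max` bookkeeping of rates and contraction factors; 0 `def`, 0 cited facts, 0 `def … : Prop`,
0 sorry).  HONEST FRAMING (cell contract, verbatim): «discharging `BetaPertH` makes Bałaban's UV stability UNCONDITIONAL — a real constructive-QFT result; it is NOT the
continuum limit and NOT the Clay problem.»  HONEST DEPENDENCY (verbatim): «continuum YM on T⁴ ⇐ BetaPertH ∧ nine spine estimates (0/9 proved); BetaPertH ⇐ (D1) ∧ (D4) ∧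
CAP+tail; G-an2-4 gates asym, D1 and NE2/3/4.»

WHAT (`d = 3`, `2 ≤ Lc`, in-block root, EXACT pin `cE₂ = Lc^{2(3+1)}`, `|ε| ≤ 1`; letters `S X R R″ cH` of the raw table laws as in FILE 3b ∕ PART 4 ∕ PART 6):
* §0 `driftRows_of_zero_succ` — a row for the first difference and ONE geometric row for the later differences (constant `B·θ^m` for the `(m+1)`-st, the
  source lag of PART 6) merge into `∀ l, … (max A (2B)·θ^l)` as soon as `½ ≤ θ` (`B ≥ 0`).
* §1 **`rate_halfMember_three_of_letterRows`** — «T2Drift^{ε}» (PART A's ∕ the OWNER's conclusion VERBATIM) ⟸ S-slot rows `hS hSall` ∧ border rows ∧ per level the raw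
  table laws `hTL hTL″` with parities `hCm hR hR″` (`∀ l`, letters `S X R R″ cH`, `hcH : cH l ≠ 0`) ∧ the S-step slot letters `hE₁ hE₂` (one constant pair, rate `δE`) ∧
  THEIR ONE-STEP DRIFTS `hEd₁ hEd₂` (PART 6a ∕ 6b's (ii′) binders at consecutive letters `S l, S (l+1)`, …, constants `CEd′·θE^l` — supplied at `ε = 1` by p2 g45's
  `BlockCommutatorStepLetterDrift.exists_evenRowsDrift_uniform_three`, staged) ∧ the LEG rows `hL₁ hL₂` and their drifts `hL₁′ hL₂′` (= (Q-L), constants `CL′·θL^l`) ∧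
  `hC` ((C)^{ε}).  Inside: common rate `δ₀ := min (min (min δb δb′) (min δE δB)) δ`, common factor `θ₁ := max ½ (max θb (max θE θL))` (`< 1`; `≥ ½` absorbs PART 6's
  one-level source lag: `B·θ₁^m ≤ 2B·θ₁^{m+1}`).
Asserts NOTHING about Bałaban's tables; every displayed row a HYPOTHESIS; discharges NOTHING of (Q-L) ∕ (C) ∕ (C)sym ∕ «T2Shape» ∕ «T2Drift» ∕ (hW, hWall); (β) of
record untouched; NEVER «G-an2-4 closed» as (CONV-C); NOT D1, NOT `BetaPertH`, NOT continuum, NOT Clay.  2026-08-23; no existing file touched.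
-/

noncomputable section

open Finset
open scoped BigOperators
open Literature.MathematicalPhysics.QuantumFieldTheory
open Literature.MathematicalPhysics.QuantumFieldTheory.Balaban1983to89
open Literature.MathematicalPhysics.QuantumFieldTheory.Balaban1983to89.Beta
open ExpKernelCalculus (MKer shiftK comp)
open OneStepResolventKernel (Fib LocStencil)
open OneStepKernelFamily (KInvStep)
open KernelWard (divV)
open AffineAveraging (box toSite unitVec)
open AveragingMixedJetTables (mixFFAt)
open SecondOrderResponse (W2SymOfK)
open BalabanCompositeJets (LocStencil₂)
open BalabanStepJetsSucc (mmRead)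
open BalabanStepW2 (K3OfK M2Of)
open Summit.QuantumFields.BalabanUV.Beta.TameKernelCalculus (trK)
open Summit.QuantumFields.BalabanUV.Beta.BorderedHessian (sgnK)
open Summit.QuantumFields.BalabanUV.Beta.HessKerDressedUnits (unitK unitS)
open Summit.QuantumFields.BalabanUV.Beta.SecondOrderUnits (unitM unitS₂ unitM₂)
open Summit.QuantumFields.BalabanUV.Beta.AxialDressingRooted (coDressKBmAt)
open Summit.QuantumFields.BalabanUV.Beta.SpineRooted (T2RecAt SpureRecAt M1At e3OfK)
open Summit.QuantumFields.BalabanUV.Beta.WardLocusRecursive (SrecAt)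
open Summit.QuantumFields.BalabanUV.Beta.GAN24.CombesThomas (sfStep smStep)
open Summit.QuantumFields.BalabanUV.Beta.GAN24.T2RecursionAffine (lin4)
open Summit.QuantumFields.BalabanUV.Beta.GAN24.BiStencilZeroMode (Tab zmode)
open Summit.QuantumFields.BalabanUV.Beta.GAN24.WSlotCauchyOfShapes (locStencil₂_le_mono)
open Summit.QuantumFields.BalabanUV.Beta.GAN24.TableDressingDefect (locStencil₂_diff)
open Summit.QuantumFields.BalabanUV.Beta.GAN24.T2ShapeEvenEnd (locStencil₂_halfTable)
open Summit.QuantumFields.BalabanUV.Beta.GAN24.T2HybridShapeEnd (locStencil₂_unitS₂_T2RecAt_zero)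
open Summit.QuantumFields.BalabanUV.Beta.GAN24.T2RecSourceRows (source_rows_three_of_srecAt_rows)
open Summit.QuantumFields.BalabanUV.Beta.GAN24.HalfMemberCellOfDivergences (letterRow_fst_of_locStencil₂ letterRow_snd_of_locStencil₂)
open Summit.QuantumFields.BalabanUV.Beta.GAN24.HalfMemberSlavedDivergenceLetters (slotLetters_halfMember_succ_of_rows)
open Summit.QuantumFields.BalabanUV.Beta.GAN24.HalfMemberSlavedDivergenceDrift (divV_fst_sub slotLetters_halfMember_succ_sub_of_rows)
open Summit.QuantumFields.BalabanUV.Beta.GAN24.HalfMemberSlavedDivergenceDriftSnd (divV_snd_sub slotLetters_snd_halfMember_succ_sub_of_rows)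
open Summit.QuantumFields.BalabanUV.Beta.GAN24.T2ShapeHalfMemberOfLetterRows (rows_of_zero_succ)
open Summit.QuantumFields.BalabanUV.Beta.GAN24.T2DriftHalfMemberOfDivergences (rate_halfMember_three_of_divergence_rows)

namespace Summit.QuantumFields.BalabanUV.Beta.GAN24.T2DriftHalfMemberOfLetterRows

/-! ## §0 Merging the first difference with the lagged geometric row of the later ones -/

/-- [folklore] A row for `T 0` and ONE geometric row `B·θ^m` for `T (m+1)` (the one-level source lag of PART 6) merge into `∀ l, LocStencil₂ (T l) (max A (2B)·θ^l) δ₀`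
as soon as `0 ≤ B` and `½ ≤ θ` (`B·θ^m ≤ 2B·θ^{m+1}`). -/
theorem driftRows_of_zero_succ {d : ℕ} {T : ℕ → Tab d} {A B θ δ₀ : ℝ} (h0 : LocStencil₂ (T 0) A δ₀) (hs : ∀ m, LocStencil₂ (T (m + 1)) (B * θ ^ m) δ₀)
    (hB : 0 ≤ B) (hθ : (1 / 2 : ℝ) ≤ θ) : ∀ l, LocStencil₂ (T l) (max A (2 * B) * θ ^ l) δ₀ := by
  have hθ0 : 0 ≤ θ := le_trans (by norm_num) hθ
  intro l
  cases l with
  | zero => simpa only [pow_zero, mul_one] using locStencil₂_le_mono h0 (le_max_left A (2 * B)) le_rfl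
  | succ m =>
    refine locStencil₂_le_mono (hs m) ?_ le_rfl
    have h1 : B * θ ^ m ≤ 2 * B * θ ^ (m + 1) := by
      rw [pow_succ]
      nlinarith [mul_nonneg hB (pow_nonneg hθ0 m)]
    exact h1.trans (mul_le_mul_of_nonneg_right (le_max_right _ _) (pow_nonneg hθ0 _))

/-- [folklore] The first-slot letter table is linear over differences of the member (`divV_fst_sub` under `funext`). -/
theorem fstTab_sub {d : ℕ} (Y Y' : Tab d) :
    (fun (_ : Fin (d + 1)) (p : Fin (d + 1) → ℤ) (κ' : Fin (d + 1)) (u' : Fin (d + 1) → ℤ) => divV (fun κ₁ u₁ => (Y - Y') κ₁ u₁ κ' u') p)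
      = (fun (_ : Fin (d + 1)) (p : Fin (d + 1) → ℤ) (κ' : Fin (d + 1)) (u' : Fin (d + 1) → ℤ) => divV (fun κ₁ u₁ => Y κ₁ u₁ κ' u') p)
        - (fun (_ : Fin (d + 1)) (p : Fin (d + 1) → ℤ) (κ' : Fin (d + 1)) (u' : Fin (d + 1) → ℤ) => divV (fun κ₁ u₁ => Y' κ₁ u₁ κ' u') p) := by
  funext a p κ' u'
  exact divV_fst_sub Y Y' p κ' u'

/-- [folklore] The second-slot letter table is linear over differences of the member (`divV_snd_sub` under `funext`). -/
theorem sndTab_sub {d : ℕ} (Y Y' : Tab d) :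
    (fun (κ : Fin (d + 1)) (u : Fin (d + 1) → ℤ) (_ : Fin (d + 1)) (p : Fin (d + 1) → ℤ) => divV (fun κ₁ u₁ => (Y - Y') κ u κ₁ u₁) p)
      = (fun (κ : Fin (d + 1)) (u : Fin (d + 1) → ℤ) (_ : Fin (d + 1)) (p : Fin (d + 1) → ℤ) => divV (fun κ₁ u₁ => Y κ u κ₁ u₁) p)
        - (fun (κ : Fin (d + 1)) (u : Fin (d + 1) → ℤ) (_ : Fin (d + 1)) (p : Fin (d + 1) → ℤ) => divV (fun κ₁ u₁ => Y' κ u κ₁ u₁) p) := by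
  funext κ u a p
  exact divV_snd_sub Y Y' κ u p

/-! ## §1 `d = 3`: the drift END with the slot rows supplied level by level -/

section Three

variable {Lc : ℕ} [NeZero Lc] {r : Fin (3 + 1) → ℕ}

/-- NOT IN PRINT; OUR BOOKKEEPING.  **«T2Drift^{ε}» FROM THE RAW TABLE LAWS WITH PARITIES, THE S-STEP SLOT LETTERS AND THEIR DRIFTS, THE LEG ROWS AND THEIR DRIFTS,
AND `hC`** (`d = 3`, `2 ≤ Lc`, in-block root, exact pin, `|ε| ≤ 1`): PART A's END with its four slot rows supplied — `y_l`: member `0` by p2's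
`locStencil₂_unitS₂_T2RecAt_zero` ⨾ the OWNER's `locStencil₂_halfTable` ⨾ FILE 2 §0, members `l+1` by PART 4 at level `l` with F4 `.1`, merged by leaf-03's
`rows_of_zero_succ`; `y_{l+1} − y_l`: `l = 0` by `locStencil₂_diff` of the two level rows (`divV_fst_sub ∕ divV_snd_sub`), `l = m+1` by PART 6a ∕ 6b at level `m`
with F4 `.2` at one step, merged by §0 at `θ₁ := max ½ (max θb (max θE θL))`; all rows at `δ₀ := min (min (min δb δb′) (min δE δB)) δ`.  DISPLAYED: raw table laws +
parities (`hTL hTL″ hCm hR hR″`, letters `S X R R″ cH`), `hE₁ hE₂`, `hEd₁ hEd₂`, the LEG rows `hL₁ hL₂ hL₁′ hL₂′` = (Q-L), `hC` = (C)^{ε}.  Nothing of (Q-L) ∕ (C) is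
discharged. -/
theorem rate_halfMember_three_of_letterRows (hLc : 2 ≤ Lc) (hr : r ∈ box (3 + 1) Lc) (cE cVH cΛ cE₂ cB : ℝ)
    (hpinEq : cE₂ = (Lc : ℝ) ^ (2 * (3 + 1))) (Tc : Fin 4 → Fin 4 → Fin 4 → Fin 4 → ℝ)
    {vh₂S : Fin (3 + 1) → (Fin (3 + 1) → ℤ) → Fin (3 + 1) → (Fin (3 + 1) → ℤ) → MKer (3 + 1) (Fib 3)}
    (hBff : ∀ κ u κ' u' x z (α β : Fin (3 + 1)), vh₂S κ u κ' u' x z (Sum.inl α) (Sum.inl β) = 0)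
    (hBmm : ∀ κ u κ' u' x z (μ ν : Fin (3 + 1)), vh₂S κ u κ' u' x z (Sum.inr μ) (Sum.inr ν) = 0)
    {CB δB : ℝ} (hB : LocStencil₂ vh₂S CB δB) (hδB : 0 < δB)
    (hBt : ∀ (κ : Fin (3 + 1)) (u : Fin (3 + 1) → ℤ) (κ' : Fin (3 + 1)) (u' t : Fin (3 + 1) → ℤ),
        vh₂S κ (u + (Lc : ℤ) • t) κ' (u' + (Lc : ℤ) • t) = shiftK (-((Lc : ℤ) • t)) (vh₂S κ u κ' u'))
    {Cs cS θS δS : ℝ} (hS : ∀ j, LocStencil (unitS (sfStep Lc j) (smStep 3 Lc j) (SrecAt 3 Lc (toSite r) cE cVH cΛ j)) Cs δS)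
    (hSall : ∀ k j, LocStencil (unitS (sfStep Lc (k + j)) (smStep 3 Lc (k + j)) (SrecAt 3 Lc (toSite r) cE cVH cΛ (k + j)) -
      unitS (sfStep Lc k) (smStep 3 Lc k) (SrecAt 3 Lc (toSite r) cE cVH cΛ k)) (cS * θS ^ k) δS)
    (hδS : 0 < δS) (hθS0 : 0 ≤ θS) (hθS1 : θS < 1)
    (ε : ℝ) (hε : |ε| ≤ 1) {S : ℕ → Fin (3 + 1) → (Fin (3 + 1) → ℤ) → MKer (3 + 1) (Fib 3)} {X : (Fin (3 + 1) → ℤ) → MKer (3 + 1) (Fib 3)}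
    {R R'' : ℕ → (Fin (3 + 1) → ℤ) → Fin (3 + 1) → (Fin (3 + 1) → ℤ) → MKer (3 + 1) (Fib 3)} {cH : ℕ → ℝ} (hcH : ∀ l, cH l ≠ 0)
    (hTL : ∀ (l : ℕ) (Y : Fin (3 + 1) → ℤ) (κ' : Fin (3 + 1)) (u' : Fin (3 + 1) → ℤ),
      cH l • ∑ v ∈ box (3 + 1) Lc, divV (fun κ u => T2RecAt 3 Lc (toSite r) cE cVH cΛ cE₂ cB Tc vh₂S (mixFFAt (toSite r) Lc) l κ u κ' u') ((Lc : ℤ) • Y + toSite v)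
        = comp (S l κ' u') (X Y) - comp (X Y) (S l κ' u') + R l Y κ' u')
    (hTL'' : ∀ (l : ℕ) (Y : Fin (3 + 1) → ℤ) (κ : Fin (3 + 1)) (u : Fin (3 + 1) → ℤ),
      cH l • ∑ v ∈ box (3 + 1) Lc, divV (T2RecAt 3 Lc (toSite r) cE cVH cΛ cE₂ cB Tc vh₂S (mixFFAt (toSite r) Lc) l κ u) ((Lc : ℤ) • Y + toSite v)
        = comp (S l κ u) (X Y) - comp (X Y) (S l κ u) + R'' l Y κ u)
    (hCm : ∀ (l : ℕ) (Y : Fin (3 + 1) → ℤ) (κ : Fin (3 + 1)) (u : Fin (3 + 1) → ℤ),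
      trK (comp (S l κ u) (X Y) - comp (X Y) (S l κ u)) = sgnK (comp (S l κ u) (X Y) - comp (X Y) (S l κ u)))
    (hR : ∀ (l : ℕ) (Y : Fin (3 + 1) → ℤ) (κ : Fin (3 + 1)) (u : Fin (3 + 1) → ℤ), trK (R l Y κ u) = -sgnK (R l Y κ u))
    (hR'' : ∀ (l : ℕ) (Y : Fin (3 + 1) → ℤ) (κ : Fin (3 + 1)) (u : Fin (3 + 1) → ℤ), trK (R'' l Y κ u) = -sgnK (R'' l Y κ u))
    {CE₁ CE₂ δE : ℝ} (hδE : 0 < δE)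
    (hE₁ : ∀ l, LocStencil₂ (fun (_ : Fin (3 + 1)) (p : Fin (3 + 1) → ℤ) (κ' : Fin (3 + 1)) (u' : Fin (3 + 1) → ℤ) =>
          (cE₂ * (Lc : ℝ) ^ (2 * (3 + 1)) * ((Lc : ℝ) ^ (3 + 1))⁻¹ / 2) •
            (e3OfK Lc (unitK (sfStep Lc l) (smStep 3 Lc l) (coDressKBmAt (toSite r) Lc (KInvStep (d := 3) Lc l)))
              (fun κ' u' => (sfStep Lc l * smStep 3 Lc l)⁻¹ • unitS (sfStep Lc l) (smStep 3 Lc l)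
                (fun κ' u' => (cH l)⁻¹ • ((((1 : ℝ) + ε) / 2) • (comp (S l κ' u') (X p) - comp (X p) (S l κ' u')) + (((1 : ℝ) - ε) / 2) • R l p κ' u')) κ' u') κ' u'
            + e3OfK Lc (unitK (sfStep Lc l) (smStep 3 Lc l) (coDressKBmAt (toSite r) Lc (KInvStep (d := 3) Lc l)))
              (fun κ u => (sfStep Lc l * smStep 3 Lc l)⁻¹ • unitS (sfStep Lc l) (smStep 3 Lc l)
                (fun κ u => (cH l)⁻¹ • ((((1 : ℝ) + ε) / 2) • (comp (S l κ u) (X p) - comp (X p) (S l κ u)) + (((1 : ℝ) - ε) / 2) • R'' l p κ u)) κ u) κ' u')) CE₁ δE)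
    (hE₂ : ∀ l, LocStencil₂ (fun (κ : Fin (3 + 1)) (u : Fin (3 + 1) → ℤ) (_ : Fin (3 + 1)) (p : Fin (3 + 1) → ℤ) =>
          (cE₂ * (Lc : ℝ) ^ (2 * (3 + 1)) * ((Lc : ℝ) ^ (3 + 1))⁻¹ / 2) •
            (e3OfK Lc (unitK (sfStep Lc l) (smStep 3 Lc l) (coDressKBmAt (toSite r) Lc (KInvStep (d := 3) Lc l)))
              (fun κ' u' => (sfStep Lc l * smStep 3 Lc l)⁻¹ • unitS (sfStep Lc l) (smStep 3 Lc l)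
                (fun κ' u' => (cH l)⁻¹ • ((((1 : ℝ) + ε) / 2) • (comp (S l κ' u') (X p) - comp (X p) (S l κ' u')) + (((1 : ℝ) - ε) / 2) • R l p κ' u')) κ' u') κ u
            + e3OfK Lc (unitK (sfStep Lc l) (smStep 3 Lc l) (coDressKBmAt (toSite r) Lc (KInvStep (d := 3) Lc l)))
              (fun κ u => (sfStep Lc l * smStep 3 Lc l)⁻¹ • unitS (sfStep Lc l) (smStep 3 Lc l)
                (fun κ u => (cH l)⁻¹ • ((((1 : ℝ) + ε) / 2) • (comp (S l κ u) (X p) - comp (X p) (S l κ u)) + (((1 : ℝ) - ε) / 2) • R'' l p κ u)) κ u) κ u)) CE₂ δE)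
    {CEd₁' CEd₂' θE : ℝ} (hθE0 : 0 ≤ θE) (hθE1 : θE < 1)
    (hEd₁ : ∀ l, LocStencil₂ (fun (_ : Fin (3 + 1)) (p : Fin (3 + 1) → ℤ) (κ' : Fin (3 + 1)) (u' : Fin (3 + 1) → ℤ) =>
          (cE₂ * (Lc : ℝ) ^ (2 * (3 + 1)) * ((Lc : ℝ) ^ (3 + 1))⁻¹ / 2) •
            (e3OfK Lc (unitK (sfStep Lc (l + 1)) (smStep 3 Lc (l + 1)) (coDressKBmAt (toSite r) Lc (KInvStep (d := 3) Lc (l + 1))))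
              (fun κ' u' => (sfStep Lc (l + 1) * smStep 3 Lc (l + 1))⁻¹ • unitS (sfStep Lc (l + 1)) (smStep 3 Lc (l + 1))
                (fun κ' u' => (cH (l + 1))⁻¹ • ((((1 : ℝ) + ε) / 2) • (comp (S (l + 1) κ' u') (X p) - comp (X p) (S (l + 1) κ' u')) + (((1 : ℝ) - ε) / 2) • R (l + 1) p κ' u')) κ' u') κ' u'
            + e3OfK Lc (unitK (sfStep Lc (l + 1)) (smStep 3 Lc (l + 1)) (coDressKBmAt (toSite r) Lc (KInvStep (d := 3) Lc (l + 1))))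
              (fun κ u => (sfStep Lc (l + 1) * smStep 3 Lc (l + 1))⁻¹ • unitS (sfStep Lc (l + 1)) (smStep 3 Lc (l + 1))
                (fun κ u => (cH (l + 1))⁻¹ • ((((1 : ℝ) + ε) / 2) • (comp (S (l + 1) κ u) (X p) - comp (X p) (S (l + 1) κ u)) + (((1 : ℝ) - ε) / 2) • R'' (l + 1) p κ u)) κ u) κ' u')
        - (cE₂ * (Lc : ℝ) ^ (2 * (3 + 1)) * ((Lc : ℝ) ^ (3 + 1))⁻¹ / 2) •
            (e3OfK Lc (unitK (sfStep Lc l) (smStep 3 Lc l) (coDressKBmAt (toSite r) Lc (KInvStep (d := 3) Lc l)))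
              (fun κ' u' => (sfStep Lc l * smStep 3 Lc l)⁻¹ • unitS (sfStep Lc l) (smStep 3 Lc l)
                (fun κ' u' => (cH l)⁻¹ • ((((1 : ℝ) + ε) / 2) • (comp (S l κ' u') (X p) - comp (X p) (S l κ' u')) + (((1 : ℝ) - ε) / 2) • R l p κ' u')) κ' u') κ' u'
            + e3OfK Lc (unitK (sfStep Lc l) (smStep 3 Lc l) (coDressKBmAt (toSite r) Lc (KInvStep (d := 3) Lc l)))
              (fun κ u => (sfStep Lc l * smStep 3 Lc l)⁻¹ • unitS (sfStep Lc l) (smStep 3 Lc l)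
                (fun κ u => (cH l)⁻¹ • ((((1 : ℝ) + ε) / 2) • (comp (S l κ u) (X p) - comp (X p) (S l κ u)) + (((1 : ℝ) - ε) / 2) • R'' l p κ u)) κ u) κ' u')) (CEd₁' * θE ^ l) δE)
    (hEd₂ : ∀ l, LocStencil₂ (fun (κ : Fin (3 + 1)) (u : Fin (3 + 1) → ℤ) (_ : Fin (3 + 1)) (p : Fin (3 + 1) → ℤ) =>
          (cE₂ * (Lc : ℝ) ^ (2 * (3 + 1)) * ((Lc : ℝ) ^ (3 + 1))⁻¹ / 2) •
            (e3OfK Lc (unitK (sfStep Lc (l + 1)) (smStep 3 Lc (l + 1)) (coDressKBmAt (toSite r) Lc (KInvStep (d := 3) Lc (l + 1))))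
              (fun κ' u' => (sfStep Lc (l + 1) * smStep 3 Lc (l + 1))⁻¹ • unitS (sfStep Lc (l + 1)) (smStep 3 Lc (l + 1))
                (fun κ' u' => (cH (l + 1))⁻¹ • ((((1 : ℝ) + ε) / 2) • (comp (S (l + 1) κ' u') (X p) - comp (X p) (S (l + 1) κ' u')) + (((1 : ℝ) - ε) / 2) • R (l + 1) p κ' u')) κ' u') κ u
            + e3OfK Lc (unitK (sfStep Lc (l + 1)) (smStep 3 Lc (l + 1)) (coDressKBmAt (toSite r) Lc (KInvStep (d := 3) Lc (l + 1))))
              (fun κ u => (sfStep Lc (l + 1) * smStep 3 Lc (l + 1))⁻¹ • unitS (sfStep Lc (l + 1)) (smStep 3 Lc (l + 1))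
                (fun κ u => (cH (l + 1))⁻¹ • ((((1 : ℝ) + ε) / 2) • (comp (S (l + 1) κ u) (X p) - comp (X p) (S (l + 1) κ u)) + (((1 : ℝ) - ε) / 2) • R'' (l + 1) p κ u)) κ u) κ u)
        - (cE₂ * (Lc : ℝ) ^ (2 * (3 + 1)) * ((Lc : ℝ) ^ (3 + 1))⁻¹ / 2) •
            (e3OfK Lc (unitK (sfStep Lc l) (smStep 3 Lc l) (coDressKBmAt (toSite r) Lc (KInvStep (d := 3) Lc l)))
              (fun κ' u' => (sfStep Lc l * smStep 3 Lc l)⁻¹ • unitS (sfStep Lc l) (smStep 3 Lc l)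
                (fun κ' u' => (cH l)⁻¹ • ((((1 : ℝ) + ε) / 2) • (comp (S l κ' u') (X p) - comp (X p) (S l κ' u')) + (((1 : ℝ) - ε) / 2) • R l p κ' u')) κ' u') κ u
            + e3OfK Lc (unitK (sfStep Lc l) (smStep 3 Lc l) (coDressKBmAt (toSite r) Lc (KInvStep (d := 3) Lc l)))
              (fun κ u => (sfStep Lc l * smStep 3 Lc l)⁻¹ • unitS (sfStep Lc l) (smStep 3 Lc l)
                (fun κ u => (cH l)⁻¹ • ((((1 : ℝ) + ε) / 2) • (comp (S l κ u) (X p) - comp (X p) (S l κ u)) + (((1 : ℝ) - ε) / 2) • R'' l p κ u)) κ u) κ u)) (CEd₂' * θE ^ l) δE)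
    {CL₁ CL₂ CL₁' CL₂' θL δ : ℝ} (hδ : 0 < δ) (hθL0 : 0 ≤ θL) (hθL1 : θL < 1)
    (hL₁ : ∀ l, LocStencil₂ (fun κ u κ' u' => fun (p z : Fin (3 + 1) → ℤ) (_ : Fib 3) (b : Fib 3) =>
      ∑ β : Fin (3 + 1), ((((1 : ℝ) / 2) • (unitS₂ (sfStep Lc l) (smStep 3 Lc l) (T2RecAt 3 Lc (toSite r) cE cVH cΛ cE₂ cB Tc vh₂S (mixFFAt (toSite r) Lc) l)
        + ε • fun κ u κ' u' => sgnK (trK ((unitS₂ (sfStep Lc l) (smStep 3 Lc l) (T2RecAt 3 Lc (toSite r) cE cVH cΛ cE₂ cB Tc vh₂S (mixFFAt (toSite r) Lc) l))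
          κ u κ' u')))) κ u κ' u' p z (Sum.inl β) b
        - (((1 : ℝ) / 2) • (unitS₂ (sfStep Lc l) (smStep 3 Lc l) (T2RecAt 3 Lc (toSite r) cE cVH cΛ cE₂ cB Tc vh₂S (mixFFAt (toSite r) Lc) l)
        + ε • fun κ u κ' u' => sgnK (trK ((unitS₂ (sfStep Lc l) (smStep 3 Lc l) (T2RecAt 3 Lc (toSite r) cE cVH cΛ cE₂ cB Tc vh₂S (mixFFAt (toSite r) Lc) l))
          κ u κ' u')))) κ u κ' u' (p - unitVec β) z (Sum.inl β) b)) CL₁ δ)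
    (hL₂ : ∀ l, LocStencil₂ (fun κ u κ' u' => fun (x p : Fin (3 + 1) → ℤ) (a : Fib 3) (_ : Fib 3) =>
      ∑ β : Fin (3 + 1), ((((1 : ℝ) / 2) • (unitS₂ (sfStep Lc l) (smStep 3 Lc l) (T2RecAt 3 Lc (toSite r) cE cVH cΛ cE₂ cB Tc vh₂S (mixFFAt (toSite r) Lc) l)
        + ε • fun κ u κ' u' => sgnK (trK ((unitS₂ (sfStep Lc l) (smStep 3 Lc l) (T2RecAt 3 Lc (toSite r) cE cVH cΛ cE₂ cB Tc vh₂S (mixFFAt (toSite r) Lc) l))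
          κ u κ' u')))) κ u κ' u' x p a (Sum.inl β)
        - (((1 : ℝ) / 2) • (unitS₂ (sfStep Lc l) (smStep 3 Lc l) (T2RecAt 3 Lc (toSite r) cE cVH cΛ cE₂ cB Tc vh₂S (mixFFAt (toSite r) Lc) l)
        + ε • fun κ u κ' u' => sgnK (trK ((unitS₂ (sfStep Lc l) (smStep 3 Lc l) (T2RecAt 3 Lc (toSite r) cE cVH cΛ cE₂ cB Tc vh₂S (mixFFAt (toSite r) Lc) l))
          κ u κ' u')))) κ u κ' u' x (p - unitVec β) a (Sum.inl β))) CL₂ δ)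
    (hL₁' : ∀ l, LocStencil₂ (fun κ u κ' u' => fun (p z : Fin (3 + 1) → ℤ) (_ : Fib 3) (b : Fib 3) =>
      ∑ β : Fin (3 + 1), (((((1 : ℝ) / 2) • (unitS₂ (sfStep Lc (l + 1)) (smStep 3 Lc (l + 1)) (T2RecAt 3 Lc (toSite r) cE cVH cΛ cE₂ cB Tc vh₂S (mixFFAt (toSite r) Lc) (l + 1))
        + ε • fun κ u κ' u' => sgnK (trK ((unitS₂ (sfStep Lc (l + 1)) (smStep 3 Lc (l + 1)) (T2RecAt 3 Lc (toSite r) cE cVH cΛ cE₂ cB Tc vh₂S (mixFFAt (toSite r) Lc) (l + 1)))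
          κ u κ' u'))))
        - (((1 : ℝ) / 2) • (unitS₂ (sfStep Lc l) (smStep 3 Lc l) (T2RecAt 3 Lc (toSite r) cE cVH cΛ cE₂ cB Tc vh₂S (mixFFAt (toSite r) Lc) l)
        + ε • fun κ u κ' u' => sgnK (trK ((unitS₂ (sfStep Lc l) (smStep 3 Lc l) (T2RecAt 3 Lc (toSite r) cE cVH cΛ cE₂ cB Tc vh₂S (mixFFAt (toSite r) Lc) l))
          κ u κ' u'))))) κ u κ' u' p z (Sum.inl β) b
        - ((((1 : ℝ) / 2) • (unitS₂ (sfStep Lc (l + 1)) (smStep 3 Lc (l + 1)) (T2RecAt 3 Lc (toSite r) cE cVH cΛ cE₂ cB Tc vh₂S (mixFFAt (toSite r) Lc) (l + 1))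
        + ε • fun κ u κ' u' => sgnK (trK ((unitS₂ (sfStep Lc (l + 1)) (smStep 3 Lc (l + 1)) (T2RecAt 3 Lc (toSite r) cE cVH cΛ cE₂ cB Tc vh₂S (mixFFAt (toSite r) Lc) (l + 1)))
          κ u κ' u'))))
        - (((1 : ℝ) / 2) • (unitS₂ (sfStep Lc l) (smStep 3 Lc l) (T2RecAt 3 Lc (toSite r) cE cVH cΛ cE₂ cB Tc vh₂S (mixFFAt (toSite r) Lc) l)
        + ε • fun κ u κ' u' => sgnK (trK ((unitS₂ (sfStep Lc l) (smStep 3 Lc l) (T2RecAt 3 Lc (toSite r) cE cVH cΛ cE₂ cB Tc vh₂S (mixFFAt (toSite r) Lc) l))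
          κ u κ' u'))))) κ u κ' u' (p - unitVec β) z (Sum.inl β) b)) (CL₁' * θL ^ l) δ)
    (hL₂' : ∀ l, LocStencil₂ (fun κ u κ' u' => fun (x p : Fin (3 + 1) → ℤ) (a : Fib 3) (_ : Fib 3) =>
      ∑ β : Fin (3 + 1), (((((1 : ℝ) / 2) • (unitS₂ (sfStep Lc (l + 1)) (smStep 3 Lc (l + 1)) (T2RecAt 3 Lc (toSite r) cE cVH cΛ cE₂ cB Tc vh₂S (mixFFAt (toSite r) Lc) (l + 1))
        + ε • fun κ u κ' u' => sgnK (trK ((unitS₂ (sfStep Lc (l + 1)) (smStep 3 Lc (l + 1)) (T2RecAt 3 Lc (toSite r) cE cVH cΛ cE₂ cB Tc vh₂S (mixFFAt (toSite r) Lc) (l + 1)))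
          κ u κ' u'))))
        - (((1 : ℝ) / 2) • (unitS₂ (sfStep Lc l) (smStep 3 Lc l) (T2RecAt 3 Lc (toSite r) cE cVH cΛ cE₂ cB Tc vh₂S (mixFFAt (toSite r) Lc) l)
        + ε • fun κ u κ' u' => sgnK (trK ((unitS₂ (sfStep Lc l) (smStep 3 Lc l) (T2RecAt 3 Lc (toSite r) cE cVH cΛ cE₂ cB Tc vh₂S (mixFFAt (toSite r) Lc) l))
          κ u κ' u'))))) κ u κ' u' x p a (Sum.inl β)
        - ((((1 : ℝ) / 2) • (unitS₂ (sfStep Lc (l + 1)) (smStep 3 Lc (l + 1)) (T2RecAt 3 Lc (toSite r) cE cVH cΛ cE₂ cB Tc vh₂S (mixFFAt (toSite r) Lc) (l + 1))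
        + ε • fun κ u κ' u' => sgnK (trK ((unitS₂ (sfStep Lc (l + 1)) (smStep 3 Lc (l + 1)) (T2RecAt 3 Lc (toSite r) cE cVH cΛ cE₂ cB Tc vh₂S (mixFFAt (toSite r) Lc) (l + 1)))
          κ u κ' u'))))
        - (((1 : ℝ) / 2) • (unitS₂ (sfStep Lc l) (smStep 3 Lc l) (T2RecAt 3 Lc (toSite r) cE cVH cΛ cE₂ cB Tc vh₂S (mixFFAt (toSite r) Lc) l)
        + ε • fun κ u κ' u' => sgnK (trK ((unitS₂ (sfStep Lc l) (smStep 3 Lc l) (T2RecAt 3 Lc (toSite r) cE cVH cΛ cE₂ cB Tc vh₂S (mixFFAt (toSite r) Lc) l))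
          κ u κ' u'))))) κ u κ' u' x (p - unitVec β) a (Sum.inl β))) (CL₂' * θL ^ l) δ)
    (hC : ∀ l, (∀ κ κ' κ₁ κ₂, zmode Lc (((1 : ℝ) / 2) • ((fun κ u κ' u' => (cE₂ * (Lc : ℝ) ^ (2 * (3 + 1))) • mmRead Lc (K3OfK (unitK (sfStep Lc l) (smStep 3 Lc l) (coDressKBmAt (toSite r) Lc (KInvStep (d :=
        3) Lc l))) Lc (unitS (sfStep Lc l) (smStep 3 Lc l) (SpureRecAt 3 Lc (toSite r) cE cVH cΛ l)) (unitM (sfStep Lc l) (smStep 3 Lc l) (M1At 3 Lc (toSite r) cΛ l)) (W2SymOfK (unitK (sfStep Lc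
        l) (smStep 3 Lc l) (coDressKBmAt (toSite r) Lc (KInvStep (d := 3) Lc l))) Lc (unitS (sfStep Lc l) (smStep 3 Lc l) (SpureRecAt 3 Lc (toSite r) cE cVH cΛ l)) (unitM (sfStep Lc l) (smStep 3
        Lc l) (M1At 3 Lc (toSite r) cΛ l)) 0 (unitM₂ (sfStep Lc l) (smStep 3 Lc l) (M2Of 3 Lc (mixFFAt (toSite r) Lc) l))) κ u κ' u') + cB • vh₂S κ u κ' u') + ε • fun κ u κ' u' => sgnK (trK
        ((cE₂ * (Lc : ℝ) ^ (2 * (3 + 1))) • mmRead Lc (K3OfK (unitK (sfStep Lc l) (smStep 3 Lc l) (coDressKBmAt (toSite r) Lc (KInvStep (d := 3) Lc l))) Lc (unitS (sfStep Lc l) (smStep 3 Lc l)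
        (SpureRecAt 3 Lc (toSite r) cE cVH cΛ l)) (unitM (sfStep Lc l) (smStep 3 Lc l) (M1At 3 Lc (toSite r) cΛ l)) (W2SymOfK (unitK (sfStep Lc l) (smStep 3 Lc l) (coDressKBmAt (toSite r) Lc
        (KInvStep (d := 3) Lc l))) Lc (unitS (sfStep Lc l) (smStep 3 Lc l) (SpureRecAt 3 Lc (toSite r) cE cVH cΛ l)) (unitM (sfStep Lc l) (smStep 3 Lc l) (M1At 3 Lc (toSite r) cΛ l)) 0 (unitM₂
        (sfStep Lc l) (smStep 3 Lc l) (M2Of 3 Lc (mixFFAt (toSite r) Lc) l))) κ u κ' u') + cB • vh₂S κ u κ' u'))) + (lin4 (cE₂ * (Lc : ℝ) ^ (2 * (3 + 1))) (unitK (sfStep Lc l) (smStep 3 Lc l)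
        (coDressKBmAt (toSite r) Lc (KInvStep (d := 3) Lc l))) Lc (((1 : ℝ) / 2) • (unitS₂ (sfStep Lc l) (smStep 3 Lc l) (T2RecAt 3 Lc (toSite r) cE cVH cΛ cE₂ cB Tc vh₂S (mixFFAt (toSite r) Lc)
        l) + ε • fun κ u κ' u' => sgnK (trK ((unitS₂ (sfStep Lc l) (smStep 3 Lc l) (T2RecAt 3 Lc (toSite r) cE cVH cΛ cE₂ cB Tc vh₂S (mixFFAt (toSite r) Lc) l)) κ u κ' u')))) - lin4 (cE₂ * (Lc :
        ℝ) ^ (2 * (3 + 1))) (unitK (sfStep Lc l) (smStep 3 Lc l) (KInvStep (d := 3) Lc l)) Lc (((1 : ℝ) / 2) • (unitS₂ (sfStep Lc l) (smStep 3 Lc l) (T2RecAt 3 Lc (toSite r) cE cVH cΛ cE₂ cB Tc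
        vh₂S (mixFFAt (toSite r) Lc) l) + ε • fun κ u κ' u' => sgnK (trK ((unitS₂ (sfStep Lc l) (smStep 3 Lc l) (T2RecAt 3 Lc (toSite r) cE cVH cΛ cE₂ cB Tc vh₂S (mixFFAt (toSite r) Lc) l)) κ u
        κ' u')))))) κ κ' (Sum.inl κ₁) (Sum.inl κ₂) + zmode Lc (((1 : ℝ) / 2) • ((fun κ u κ' u' => (cE₂ * (Lc : ℝ) ^ (2 * (3 + 1))) • mmRead Lc (K3OfK (unitK (sfStep Lc l) (smStep 3 Lc l)
        (coDressKBmAt (toSite r) Lc (KInvStep (d := 3) Lc l))) Lc (unitS (sfStep Lc l) (smStep 3 Lc l) (SpureRecAt 3 Lc (toSite r) cE cVH cΛ l)) (unitM (sfStep Lc l) (smStep 3 Lc l) (M1At 3 Lc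
        (toSite r) cΛ l)) (W2SymOfK (unitK (sfStep Lc l) (smStep 3 Lc l) (coDressKBmAt (toSite r) Lc (KInvStep (d := 3) Lc l))) Lc (unitS (sfStep Lc l) (smStep 3 Lc l) (SpureRecAt 3 Lc (toSite
        r) cE cVH cΛ l)) (unitM (sfStep Lc l) (smStep 3 Lc l) (M1At 3 Lc (toSite r) cΛ l)) 0 (unitM₂ (sfStep Lc l) (smStep 3 Lc l) (M2Of 3 Lc (mixFFAt (toSite r) Lc) l))) κ u κ' u') + cB • vh₂S
        κ u κ' u') + ε • fun κ u κ' u' => sgnK (trK ((cE₂ * (Lc : ℝ) ^ (2 * (3 + 1))) • mmRead Lc (K3OfK (unitK (sfStep Lc l) (smStep 3 Lc l) (coDressKBmAt (toSite r) Lc (KInvStep (d := 3) Lc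
        l))) Lc (unitS (sfStep Lc l) (smStep 3 Lc l) (SpureRecAt 3 Lc (toSite r) cE cVH cΛ l)) (unitM (sfStep Lc l) (smStep 3 Lc l) (M1At 3 Lc (toSite r) cΛ l)) (W2SymOfK (unitK (sfStep Lc l)
        (smStep 3 Lc l) (coDressKBmAt (toSite r) Lc (KInvStep (d := 3) Lc l))) Lc (unitS (sfStep Lc l) (smStep 3 Lc l) (SpureRecAt 3 Lc (toSite r) cE cVH cΛ l)) (unitM (sfStep Lc l) (smStep 3 Lc
        l) (M1At 3 Lc (toSite r) cΛ l)) 0 (unitM₂ (sfStep Lc l) (smStep 3 Lc l) (M2Of 3 Lc (mixFFAt (toSite r) Lc) l))) κ u κ' u') + cB • vh₂S κ u κ' u'))) + (lin4 (cE₂ * (Lc : ℝ) ^ (2 * (3 +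
        1))) (unitK (sfStep Lc l) (smStep 3 Lc l) (coDressKBmAt (toSite r) Lc (KInvStep (d := 3) Lc l))) Lc (((1 : ℝ) / 2) • (unitS₂ (sfStep Lc l) (smStep 3 Lc l) (T2RecAt 3 Lc (toSite r) cE cVH
        cΛ cE₂ cB Tc vh₂S (mixFFAt (toSite r) Lc) l) + ε • fun κ u κ' u' => sgnK (trK ((unitS₂ (sfStep Lc l) (smStep 3 Lc l) (T2RecAt 3 Lc (toSite r) cE cVH cΛ cE₂ cB Tc vh₂S (mixFFAt (toSite r)
        Lc) l)) κ u κ' u')))) - lin4 (cE₂ * (Lc : ℝ) ^ (2 * (3 + 1))) (unitK (sfStep Lc l) (smStep 3 Lc l) (KInvStep (d := 3) Lc l)) Lc (((1 : ℝ) / 2) • (unitS₂ (sfStep Lc l) (smStep 3 Lc l)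
        (T2RecAt 3 Lc (toSite r) cE cVH cΛ cE₂ cB Tc vh₂S (mixFFAt (toSite r) Lc) l) + ε • fun κ u κ' u' => sgnK (trK ((unitS₂ (sfStep Lc l) (smStep 3 Lc l) (T2RecAt 3 Lc (toSite r) cE cVH cΛ
        cE₂ cB Tc vh₂S (mixFFAt (toSite r) Lc) l)) κ u κ' u')))))) κ' κ (Sum.inl κ₁) (Sum.inl κ₂) = 0)) :
    ∃ c ϑ δ : ℝ, 0 ≤ c ∧ 0 < ϑ ∧ ϑ < 1 ∧ 0 < δ ∧
      (∀ n, LocStencil₂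
        ((((1 : ℝ) / 2) • (unitS₂ (sfStep Lc (n + 1)) (smStep 3 Lc (n + 1)) (T2RecAt 3 Lc (toSite r) cE cVH cΛ cE₂ cB Tc vh₂S (mixFFAt (toSite r) Lc) (n + 1)) + ε • fun κ u κ' u' => sgnK (trK ((unitS₂
          (sfStep Lc (n + 1)) (smStep 3 Lc (n + 1)) (T2RecAt 3 Lc (toSite r) cE cVH cΛ cE₂ cB Tc vh₂S (mixFFAt (toSite r) Lc) (n + 1))) κ u κ' u')))) -
         (((1 : ℝ) / 2) • (unitS₂ (sfStep Lc n) (smStep 3 Lc n) (T2RecAt 3 Lc (toSite r) cE cVH cΛ cE₂ cB Tc vh₂S (mixFFAt (toSite r) Lc) n) + ε • fun κ u κ' u' => sgnK (trK ((unitS₂ (sfStep Lc n)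
          (smStep 3 Lc n) (T2RecAt 3 Lc (toSite r) cE cVH cΛ cE₂ cB Tc vh₂S (mixFFAt (toSite r) Lc) n)) κ u κ' u'))))) (c * ϑ ^ n) δ) ∧
      (∀ k j, LocStencil₂
        ((((1 : ℝ) / 2) • (unitS₂ (sfStep Lc (k + j)) (smStep 3 Lc (k + j)) (T2RecAt 3 Lc (toSite r) cE cVH cΛ cE₂ cB Tc vh₂S (mixFFAt (toSite r) Lc) (k + j)) + ε • fun κ u κ' u' => sgnK (trK ((unitS₂
          (sfStep Lc (k + j)) (smStep 3 Lc (k + j)) (T2RecAt 3 Lc (toSite r) cE cVH cΛ cE₂ cB Tc vh₂S (mixFFAt (toSite r) Lc) (k + j))) κ u κ' u')))) -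
         (((1 : ℝ) / 2) • (unitS₂ (sfStep Lc k) (smStep 3 Lc k) (T2RecAt 3 Lc (toSite r) cE cVH cΛ cE₂ cB Tc vh₂S (mixFFAt (toSite r) Lc) k) + ε • fun κ u κ' u' => sgnK (trK ((unitS₂ (sfStep Lc k)
          (smStep 3 Lc k) (T2RecAt 3 Lc (toSite r) cE cVH cΛ cE₂ cB Tc vh₂S (mixFFAt (toSite r) Lc) k)) κ u κ' u'))))) (c * (1 - ϑ)⁻¹ * ϑ ^ k) δ) := by
  have hLc1 : 1 ≤ Lc := le_trans (by norm_num) hLc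
  -- p2's F4: the dressed comb sources are uniformly `LocStencil₂` and Cauchy (from the S-slot rows)
  obtain ⟨⟨Cb, δb, hδb, hbF4⟩, ⟨cb, θb, δb', hcb, hθb0, hθb1, hδb', hbd⟩⟩ :=
    source_rows_three_of_srecAt_rows hLc hr cE cVH cΛ cE₂ cB (vh₂S := vh₂S) hB hδB hS hSall hδS hθS0 hθS1
  -- the common rate
  have hδ₀ : 0 < min (min (min δb δb') (min δE δB)) δ := lt_min (lt_min (lt_min hδb hδb') (lt_min hδE hδB)) hδ
  have hδ₀b : min (min (min δb δb') (min δE δB)) δ ≤ δb := ((min_le_left _ _).trans (min_le_left _ _)).trans (min_le_left _ _)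
  have hδ₀b' : min (min (min δb δb') (min δE δB)) δ ≤ δb' := ((min_le_left _ _).trans (min_le_left _ _)).trans (min_le_right _ _)
  have hδ₀E : min (min (min δb δb') (min δE δB)) δ ≤ δE := ((min_le_left _ _).trans (min_le_right _ _)).trans (min_le_left _ _)
  have hδ₀B : min (min (min δb δb') (min δE δB)) δ ≤ δB := ((min_le_left _ _).trans (min_le_right _ _)).trans (min_le_right _ _)
  have hδ₀L : min (min (min δb δb') (min δE δB)) δ ≤ δ := min_le_right _ _
  -- the common contraction factor (`≥ ½` to absorb the source lag)
  have hθ₁h : (1 / 2 : ℝ) ≤ max (1 / 2 : ℝ) (max θb (max θE θL)) := le_max_left _ _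
  have hθ₁0 : 0 ≤ max (1 / 2 : ℝ) (max θb (max θE θL)) := le_trans (by norm_num) hθ₁h
  have hθ₁1 : max (1 / 2 : ℝ) (max θb (max θE θL)) < 1 := max_lt (by norm_num) (max_lt hθb1 (max_lt hθE1 hθL1))
  have hθb₁ : θb ≤ max (1 / 2 : ℝ) (max θb (max θE θL)) := (le_max_left _ _).trans (le_max_right _ _)
  have hθE₁ : θE ≤ max (1 / 2 : ℝ) (max θb (max θE θL)) := ((le_max_left _ _).trans (le_max_right _ _)).trans (le_max_right _ _)
  have hθL₁ : θL ≤ max (1 / 2 : ℝ) (max θb (max θE θL)) := ((le_max_right _ _).trans (le_max_right _ _)).trans (le_max_right _ _)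
  -- LEVEL ROWS (leaf-03's FILE 3b route): member 0, then members l+1 by PART 4 at level l
  have h0 := locStencil₂_halfTable (locStencil₂_unitS₂_T2RecAt_zero (d := 3) (Lc := Lc) (toSite r) cE cVH cΛ cE₂ cB Tc (mixFFAt (toSite r) Lc) hB hδB.le le_rfl) hε
  have h0₁ := letterRow_fst_of_locStencil₂ h0 hδB.le
  have h0₂ := letterRow_snd_of_locStencil₂ h0 hδB.le
  have hsucc := fun l => slotLetters_halfMember_succ_of_rows (d := 3) hLc1 hr cE cVH cΛ cE₂ cB Tc hBff hBmm ⟨CB, δB, hδB, hB⟩ l (hcH l) (hTL l) (hTL'' l)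
    (hCm l) (hR l) (hR'' l) ε hε hδ₀.le ((hbF4 l).mono hδ₀b) ((hE₁ l).mono hδ₀E) ((hE₂ l).mono hδ₀E)
  have h₁ := rows_of_zero_succ
    (T := fun l => fun (_ : Fin (3 + 1)) (p : Fin (3 + 1) → ℤ) (κ' : Fin (3 + 1)) (u' : Fin (3 + 1) → ℤ) =>
          divV (fun κ₁ u₁ => (((1 : ℝ) / 2) • (unitS₂ (sfStep Lc l) (smStep 3 Lc l) (T2RecAt 3 Lc (toSite r) cE cVH cΛ cE₂ cB Tc vh₂S (mixFFAt (toSite r) Lc) l)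
            + ε • fun κ u κ' u' => sgnK (trK ((unitS₂ (sfStep Lc l) (smStep 3 Lc l) (T2RecAt 3 Lc (toSite r) cE cVH cΛ cE₂ cB Tc vh₂S (mixFFAt (toSite r) Lc) l))
              κ u κ' u')))) κ₁ u₁ κ' u') p)
    h0₁ (fun l => (hsucc l).1) hδ₀B le_rfl
  have h₂ := rows_of_zero_succ
    (T := fun l => fun (κ : Fin (3 + 1)) (u : Fin (3 + 1) → ℤ) (_ : Fin (3 + 1)) (p : Fin (3 + 1) → ℤ) =>
          divV (fun κ₁ u₁ => (((1 : ℝ) / 2) • (unitS₂ (sfStep Lc l) (smStep 3 Lc l) (T2RecAt 3 Lc (toSite r) cE cVH cΛ cE₂ cB Tc vh₂S (mixFFAt (toSite r) Lc) l)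
            + ε • fun κ u κ' u' => sgnK (trK ((unitS₂ (sfStep Lc l) (smStep 3 Lc l) (T2RecAt 3 Lc (toSite r) cE cVH cΛ cE₂ cB Tc vh₂S (mixFFAt (toSite r) Lc) l))
              κ u κ' u')))) κ u κ₁ u₁) p)
    h0₂ (fun l => (hsucc l).2) hδ₀B le_rfl
  -- DRIFT ROWS, l = m+1: PART 6a ∕ 6b at level m (F4's Cauchy half at one step, the displayed letter drifts), then one constant `B·θ₁^m`
  have hK₁ : 0 ≤ ((3 : ℝ) + 1) * (Real.exp (3 * min (min (min δb δb') (min δE δB)) δ) + 1) := by positivity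
  have hK₂ : 0 ≤ ((3 : ℝ) + 1) * (Real.exp (min (min (min δb δb') (min δE δB)) δ) + 1) := by positivity
  have hds₁ : ∀ m, LocStencil₂ (fun (_ : Fin (3 + 1)) (p : Fin (3 + 1) → ℤ) (κ' : Fin (3 + 1)) (u' : Fin (3 + 1) → ℤ) =>
            divV (fun κ₁ u₁ => ((((1 : ℝ) / 2) • (unitS₂ (sfStep Lc (m + 1 + 1)) (smStep 3 Lc (m + 1 + 1)) (T2RecAt 3 Lc (toSite r) cE cVH cΛ cE₂ cB Tc vh₂S (mixFFAt (toSite r) Lc) (m + 1 + 1))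
              + ε • fun κ u κ' u' => sgnK (trK ((unitS₂ (sfStep Lc (m + 1 + 1)) (smStep 3 Lc (m + 1 + 1)) (T2RecAt 3 Lc (toSite r) cE cVH cΛ cE₂ cB Tc vh₂S (mixFFAt (toSite r) Lc) (m + 1 + 1)))
                κ u κ' u'))))
              - (((1 : ℝ) / 2) • (unitS₂ (sfStep Lc (m + 1)) (smStep 3 Lc (m + 1)) (T2RecAt 3 Lc (toSite r) cE cVH cΛ cE₂ cB Tc vh₂S (mixFFAt (toSite r) Lc) (m + 1))
              + ε • fun κ u κ' u' => sgnK (trK ((unitS₂ (sfStep Lc (m + 1)) (smStep 3 Lc (m + 1)) (T2RecAt 3 Lc (toSite r) cE cVH cΛ cE₂ cB Tc vh₂S (mixFFAt (toSite r) Lc) (m + 1)))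
                κ u κ' u'))))) κ₁ u₁ κ' u') p)
      ((((3 : ℝ) + 1) * (Real.exp (3 * min (min (min δb δb') (min δE δB)) δ) + 1) * cb + |CEd₁'|) * (max (1 / 2 : ℝ) (max θb (max θE θL))) ^ m)
      (min (min (min δb δb') (min δE δB)) δ) := by
    intro m
    have h := slotLetters_halfMember_succ_sub_of_rows (d := 3) hLc1 hr cE cVH cΛ cE₂ cB Tc hBff hBmm ⟨CB, δB, hδB, hB⟩ m (hcH m) (hTL m) (hTL'' m)
      (hCm m) (hR m) (hR'' m) (hcH (m + 1)) (hTL (m + 1)) (hTL'' (m + 1)) (hCm (m + 1)) (hR (m + 1)) (hR'' (m + 1)) ε hε hδ₀.le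
      ((hbd m 1).mono hδ₀b') ((hEd₁ m).mono hδ₀E)
    refine locStencil₂_le_mono h ?_ le_rfl
    have hp1 : θb ^ m ≤ (max (1 / 2 : ℝ) (max θb (max θE θL))) ^ m := pow_le_pow_left₀ hθb0 hθb₁ m
    have hp2 : θE ^ m ≤ (max (1 / 2 : ℝ) (max θb (max θE θL))) ^ m := pow_le_pow_left₀ hθE0 hθE₁ m
    have a1 : ((3 : ℝ) + 1) * (Real.exp (3 * min (min (min δb δb') (min δE δB)) δ) + 1) * (cb * θb ^ m)
        ≤ ((3 : ℝ) + 1) * (Real.exp (3 * min (min (min δb δb') (min δE δB)) δ) + 1) * cb * (max (1 / 2 : ℝ) (max θb (max θE θL))) ^ m := by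
      rw [mul_assoc _ cb]
      exact mul_le_mul_of_nonneg_left (mul_le_mul_of_nonneg_left hp1 hcb) hK₁
    have a2 : CEd₁' * θE ^ m ≤ |CEd₁'| * (max (1 / 2 : ℝ) (max θb (max θE θL))) ^ m :=
      (le_abs_self _).trans (by
        rw [abs_mul, abs_of_nonneg (pow_nonneg hθE0 m)]
        exact mul_le_mul_of_nonneg_left hp2 (abs_nonneg _))
    nlinarith [a1, a2]
  have hds₂ : ∀ m, LocStencil₂ (fun (κ : Fin (3 + 1)) (u : Fin (3 + 1) → ℤ) (_ : Fin (3 + 1)) (p : Fin (3 + 1) → ℤ) =>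
            divV (fun κ₁ u₁ => ((((1 : ℝ) / 2) • (unitS₂ (sfStep Lc (m + 1 + 1)) (smStep 3 Lc (m + 1 + 1)) (T2RecAt 3 Lc (toSite r) cE cVH cΛ cE₂ cB Tc vh₂S (mixFFAt (toSite r) Lc) (m + 1 + 1))
              + ε • fun κ u κ' u' => sgnK (trK ((unitS₂ (sfStep Lc (m + 1 + 1)) (smStep 3 Lc (m + 1 + 1)) (T2RecAt 3 Lc (toSite r) cE cVH cΛ cE₂ cB Tc vh₂S (mixFFAt (toSite r) Lc) (m + 1 + 1)))
                κ u κ' u'))))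
              - (((1 : ℝ) / 2) • (unitS₂ (sfStep Lc (m + 1)) (smStep 3 Lc (m + 1)) (T2RecAt 3 Lc (toSite r) cE cVH cΛ cE₂ cB Tc vh₂S (mixFFAt (toSite r) Lc) (m + 1))
              + ε • fun κ u κ' u' => sgnK (trK ((unitS₂ (sfStep Lc (m + 1)) (smStep 3 Lc (m + 1)) (T2RecAt 3 Lc (toSite r) cE cVH cΛ cE₂ cB Tc vh₂S (mixFFAt (toSite r) Lc) (m + 1)))
                κ u κ' u'))))) κ u κ₁ u₁) p)
      ((((3 : ℝ) + 1) * (Real.exp (min (min (min δb δb') (min δE δB)) δ) + 1) * cb + |CEd₂'|) * (max (1 / 2 : ℝ) (max θb (max θE θL))) ^ m)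
      (min (min (min δb δb') (min δE δB)) δ) := by
    intro m
    have h := slotLetters_snd_halfMember_succ_sub_of_rows (d := 3) hLc1 hr cE cVH cΛ cE₂ cB Tc hBff hBmm ⟨CB, δB, hδB, hB⟩ m (hcH m) (hTL m) (hTL'' m)
      (hCm m) (hR m) (hR'' m) (hcH (m + 1)) (hTL (m + 1)) (hTL'' (m + 1)) (hCm (m + 1)) (hR (m + 1)) (hR'' (m + 1)) ε hε hδ₀.le
      ((hbd m 1).mono hδ₀b') ((hEd₂ m).mono hδ₀E)
    refine locStencil₂_le_mono h ?_ le_rfl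
    have hp1 : θb ^ m ≤ (max (1 / 2 : ℝ) (max θb (max θE θL))) ^ m := pow_le_pow_left₀ hθb0 hθb₁ m
    have hp2 : θE ^ m ≤ (max (1 / 2 : ℝ) (max θb (max θE θL))) ^ m := pow_le_pow_left₀ hθE0 hθE₁ m
    have a1 : ((3 : ℝ) + 1) * (Real.exp (min (min (min δb δb') (min δE δB)) δ) + 1) * (cb * θb ^ m)
        ≤ ((3 : ℝ) + 1) * (Real.exp (min (min (min δb δb') (min δE δB)) δ) + 1) * cb * (max (1 / 2 : ℝ) (max θb (max θE θL))) ^ m := by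
      rw [mul_assoc _ cb]
      exact mul_le_mul_of_nonneg_left (mul_le_mul_of_nonneg_left hp1 hcb) hK₂
    have a2 : CEd₂' * θE ^ m ≤ |CEd₂'| * (max (1 / 2 : ℝ) (max θb (max θE θL))) ^ m :=
      (le_abs_self _).trans (by
        rw [abs_mul, abs_of_nonneg (pow_nonneg hθE0 m)]
        exact mul_le_mul_of_nonneg_left hp2 (abs_nonneg _))
    nlinarith [a1, a2]
  -- DRIFT ROWS, all l: §0 merges the first difference (the two level rows of `y_1` and `y_0`, `locStencil₂_diff`) with the lagged rows
  have h₁' := driftRows_of_zero_succ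
    (T := fun l => fun (_ : Fin (3 + 1)) (p : Fin (3 + 1) → ℤ) (κ' : Fin (3 + 1)) (u' : Fin (3 + 1) → ℤ) =>
          divV (fun κ₁ u₁ => ((((1 : ℝ) / 2) • (unitS₂ (sfStep Lc (l + 1)) (smStep 3 Lc (l + 1)) (T2RecAt 3 Lc (toSite r) cE cVH cΛ cE₂ cB Tc vh₂S (mixFFAt (toSite r) Lc) (l + 1))
            + ε • fun κ u κ' u' => sgnK (trK ((unitS₂ (sfStep Lc (l + 1)) (smStep 3 Lc (l + 1)) (T2RecAt 3 Lc (toSite r) cE cVH cΛ cE₂ cB Tc vh₂S (mixFFAt (toSite r) Lc) (l + 1)))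
              κ u κ' u'))))
            - (((1 : ℝ) / 2) • (unitS₂ (sfStep Lc l) (smStep 3 Lc l) (T2RecAt 3 Lc (toSite r) cE cVH cΛ cE₂ cB Tc vh₂S (mixFFAt (toSite r) Lc) l)
            + ε • fun κ u κ' u' => sgnK (trK ((unitS₂ (sfStep Lc l) (smStep 3 Lc l) (T2RecAt 3 Lc (toSite r) cE cVH cΛ cE₂ cB Tc vh₂S (mixFFAt (toSite r) Lc) l))
              κ u κ' u'))))) κ₁ u₁ κ' u') p)
    (by simpa only [fstTab_sub] using locStencil₂_diff (hsucc 0).1 (h0₁.mono hδ₀B)) hds₁ (by positivity) hθ₁h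
  have h₂' := driftRows_of_zero_succ
    (T := fun l => fun (κ : Fin (3 + 1)) (u : Fin (3 + 1) → ℤ) (_ : Fin (3 + 1)) (p : Fin (3 + 1) → ℤ) =>
          divV (fun κ₁ u₁ => ((((1 : ℝ) / 2) • (unitS₂ (sfStep Lc (l + 1)) (smStep 3 Lc (l + 1)) (T2RecAt 3 Lc (toSite r) cE cVH cΛ cE₂ cB Tc vh₂S (mixFFAt (toSite r) Lc) (l + 1))
            + ε • fun κ u κ' u' => sgnK (trK ((unitS₂ (sfStep Lc (l + 1)) (smStep 3 Lc (l + 1)) (T2RecAt 3 Lc (toSite r) cE cVH cΛ cE₂ cB Tc vh₂S (mixFFAt (toSite r) Lc) (l + 1)))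
              κ u κ' u'))))
            - (((1 : ℝ) / 2) • (unitS₂ (sfStep Lc l) (smStep 3 Lc l) (T2RecAt 3 Lc (toSite r) cE cVH cΛ cE₂ cB Tc vh₂S (mixFFAt (toSite r) Lc) l)
            + ε • fun κ u κ' u' => sgnK (trK ((unitS₂ (sfStep Lc l) (smStep 3 Lc l) (T2RecAt 3 Lc (toSite r) cE cVH cΛ cE₂ cB Tc vh₂S (mixFFAt (toSite r) Lc) l))
              κ u κ' u'))))) κ u κ₁ u₁) p)
    (by simpa only [sndTab_sub] using locStencil₂_diff (hsucc 0).2 (h0₂.mono hδ₀B)) hds₂ (by positivity) hθ₁h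
  -- LEG DRIFT ROWS at the common factor
  have hCL : ∀ (C : ℝ) (l : ℕ), C * θL ^ l ≤ |C| * (max (1 / 2 : ℝ) (max θb (max θE θL))) ^ l := fun C l =>
    (le_abs_self _).trans (by
      rw [abs_mul, abs_of_nonneg (pow_nonneg hθL0 l)]
      exact mul_le_mul_of_nonneg_left (pow_le_pow_left₀ hθL0 hθL₁ l) (abs_nonneg _))
  have hL₁'' := fun l => locStencil₂_le_mono (hL₁' l) (hCL CL₁' l) hδ₀L
  have hL₂'' := fun l => locStencil₂_le_mono (hL₂' l) (hCL CL₂' l) hδ₀L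
  exact rate_halfMember_three_of_divergence_rows hLc hr cE cVH cΛ cE₂ cB hpinEq Tc hBff hBmm hB hδB hBt hS hSall hδS hθS0 hθS1 ε hε hδ₀ hθ₁0 hθ₁1
    h₂ h₁ (fun l => (hL₁ l).mono hδ₀L) (fun l => (hL₂ l).mono hδ₀L) h₂' h₁' hL₁'' hL₂'' hC

end Three

end Summit.QuantumFields.BalabanUV.Beta.GAN24.T2DriftHalfMemberOfLetterRows

end
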